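import Summits.HubbardSuperconductivity.HubbardLadder.Targets
import Summits.HubbardSuperconductivity.HubbardLadder.R3R4Props
import Literature.MathematicalPhysics.QuantumManyBody.StateRelaxationDuality
import Literature.MathematicalPhysics.QuantumLattice.FinDimSpectrumSectorGibbsLimit
import Literature.MathematicalPhysics.QuantumLattice.HeisenbergOrderNeelShortRange
import HarnessLib

/-!
# Rung R2 — soundness of the energy-window observable certificate, part 1/3 (abstract form, tracial state)

HONEST FRAMING (page 1): ladder R1–R4 with certified numbers; no claim on H/H₀.
(The r2 seat's `ObservableWindow` split into three files for the 400-line limit, statements unchanged: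
`ObservableWindowAbstract` = §1 window arithmetic, §2 abstract `⋆`-algebra certificate lemmas, §3a tracial
ground-state instances; `ObservableWindowVector` = §3b eigenvector / sector-ground-state / symmetrised
instances; `ObservableWindow` = §4 Hubbard rows + §5 Heisenberg rows and the full overview docstring;
import `ObservableWindow` to get everything.)

This part: (D1) window arithmetic (`obs_lower_of_window`, `obs_upper_of_window`); the abstract certificate
lemmas `le_re_map_of_windowCertificate[_residual]` — an identity `V - c·1 = Σ Λᵢⱼ Oᵢ⋆Oⱼ + nulls + μ·(E_up·1 - H) (+ r)`
with `Λ ⪰ 0`, `μ ≥ 0`, `ω(nulls) = 0`, `Re ω(H) ≤ E_up` gives `c (- ε) ≤ Re ω(V)` for a normalised positive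
functional `ω` (the dual form of Wang et al., PRX 2024, §3 eq. (4)) — and the scan forms
`le_re_map_of_scanCertificate` / `re_map_le_of_scanCertificate`; the tracial ground-state instances
`re_groundStateFunctional_ge/le_of_windowCertificate[_residual]` (null terms: commutators with `A` and
symmetry defects `U Y Uᴴ - Y`) and `re_groundStateFunctional_ge_of_groundEnergy_add_smul` /
`_le_of_groundEnergy_sub_smul` (any certified `c ≤ E₀(A ± λV)` plus `E₀(A) ≤ E_up` brackets `Re ω₀(V)`).
No certificate exists; these are soundness edges.
-/

namespace Summit.HubbardSuperconductivity.HubbardLadder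

open Matrix Finset Filter Literature.Probability.LatticeModels
  Literature.MathematicalPhysics.QuantumLattice
  Literature.MathematicalPhysics.QuantumManyBody.StateRelaxation
open scoped ComplexOrder

noncomputable section

/-! ## §1 Window arithmetic (D1): energy window + a bound on `⟨H ± λV⟩` ⇒ a bound on `⟨V⟩` -/

/-- `ω(H) ≤ E_up`, `c ≤ ω(H) + λ ω(V)`, `λ > 0` ⇒ `(c - E_up)/λ ≤ ω(V)`. [folklore] -/
theorem obs_lower_of_window {ωH ωV Eup c lam : ℝ} (hE : ωH ≤ Eup) (hc : c ≤ ωH + lam * ωV)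
    (hlam : 0 < lam) : (c - Eup) / lam ≤ ωV := by
  rw [div_le_iff₀ hlam]; linarith

/-- `ω(H) ≤ E_up`, `c ≤ ω(H) - λ ω(V)`, `λ > 0` ⇒ `ω(V) ≤ (E_up - c)/λ`. [folklore] -/
theorem obs_upper_of_window {ωH ωV Eup c lam : ℝ} (hE : ωH ≤ Eup) (hc : c ≤ ωH - lam * ωV)
    (hlam : 0 < lam) : ωV ≤ (Eup - c) / lam := by
  rw [le_div_iff₀ hlam]; linarith

/-! ## §2 Abstract `⋆`-algebra form: the window certificate lemma -/

section Abstract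

variable {𝓐 : Type*} [Ring 𝓐] [StarRing 𝓐] [Algebra ℂ 𝓐] [StarModule ℂ 𝓐]
variable {m : Type*} [Fintype m] [DecidableEq m]

omit [StarRing 𝓐] [StarModule ℂ 𝓐] in
/-- The window term has nonnegative expectation in any normalised state of energy at most `E_up`:
`0 ≤ Re ω(μ·(E_up·1 - h))` for `μ ≥ 0`, `Re ω(h) ≤ E_up`. [cite: WangEtAl2024, §3 eq. (4)] -/
theorem re_map_window_nonneg (ω : 𝓐 →ₗ[ℂ] ℂ) (hone : ω 1 = 1) {h : 𝓐} {Eup μ : ℝ} (hμ : 0 ≤ μ)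
    (hE : (ω h).re ≤ Eup) : 0 ≤ (ω ((μ : ℂ) • ((Eup : ℂ) • (1 : 𝓐) - h))).re := by
  rw [map_smul, map_sub, map_smul, hone, smul_eq_mul, smul_eq_mul, mul_one, Complex.re_ofReal_mul,
    Complex.sub_re, Complex.ofReal_re]
  exact mul_nonneg hμ (sub_nonneg.mpr hE)

/-- **Window certificate with residual (R2 soundness, abstract form).** For a positive normalised
functional `ω` with `Re ω(h) ≤ E_up`: an identity
`v - c·1 = Σᵢⱼ Λᵢⱼ Oᵢ⋆Oⱼ + n + μ·(E_up·1 - h) + r` with `Λ ⪰ 0`, `ω(n) = 0`, `μ ≥ 0`,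
`-ε ≤ Re ω(r)` proves `c - ε ≤ Re ω(v)`. (The multiplier `μ` is the dual variable of the energy
constraint `⟨E_up - H⟩ ≥ 0` of Wang et al. (2024) eq. (4); `r` absorbs rounding, KSDN 2024 §5.3.)
[cite: WangEtAl2024, §3 eq. (4)] [cite: KullEtAl2024, §5.3] -/
theorem le_re_map_of_windowCertificate_residual (ω : 𝓐 →ₗ[ℂ] ℂ)
    (hpos : ∀ a, 0 ≤ ω (star a * a)) (hone : ω 1 = 1) {Λ : Matrix m m ℂ} (hΛ : Λ.PosSemidef)
    (O : m → 𝓐) {h v n r : 𝓐} (hn : ω n = 0) {ε : ℝ} (hr : -ε ≤ (ω r).re)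
    {Eup μ c : ℝ} (hμ : 0 ≤ μ) (hE : (ω h).re ≤ Eup)
    (hcert : v - (c : ℂ) • (1 : 𝓐) =
      gramForm Λ O + n + (μ : ℂ) • ((Eup : ℂ) • (1 : 𝓐) - h) + r) :
    c - ε ≤ (ω v).re := by
  have hw := re_map_window_nonneg ω hone (h := h) hμ hE
  have key := le_re_map_of_certificate_residual ω hpos hone hΛ O hn (ε := ε)
    (r := (μ : ℂ) • ((Eup : ℂ) • (1 : 𝓐) - h) + r) (c := c) (h := v)
    (by rw [map_add, Complex.add_re]; linarith) (by rw [hcert, add_assoc])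
  exact key

/-- **Window certificate (R2 soundness, abstract form; exact identity).** As
`le_re_map_of_windowCertificate_residual` with no residual: `v - c·1 = Σᵢⱼ Λᵢⱼ Oᵢ⋆Oⱼ + n + μ·(E_up·1 - h)`,
`Λ ⪰ 0`, `ω(n) = 0`, `μ ≥ 0`, `Re ω(h) ≤ E_up` ⇒ `c ≤ Re ω(v)`. [cite: WangEtAl2024, §3 eq. (4)] -/
theorem le_re_map_of_windowCertificate (ω : 𝓐 →ₗ[ℂ] ℂ)
    (hpos : ∀ a, 0 ≤ ω (star a * a)) (hone : ω 1 = 1) {Λ : Matrix m m ℂ} (hΛ : Λ.PosSemidef)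
    (O : m → 𝓐) {h v n : 𝓐} (hn : ω n = 0) {Eup μ c : ℝ} (hμ : 0 ≤ μ) (hE : (ω h).re ≤ Eup)
    (hcert : v - (c : ℂ) • (1 : 𝓐) = gramForm Λ O + n + (μ : ℂ) • ((Eup : ℂ) • (1 : 𝓐) - h)) :
    c ≤ (ω v).re := by
  have key := le_re_map_of_windowCertificate_residual ω hpos hone hΛ O hn (r := 0) (ε := 0)
    (by rw [map_zero, Complex.zero_re, neg_zero]) hμ hE (c := c) (v := v) (by rw [hcert, add_zero])
  simpa using key

/-- **Scan form, lower (D1).** A plain energy certificate for the tilted operator,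
`h + λ v - c·1 = Σᵢⱼ Λᵢⱼ Oᵢ⋆Oⱼ + n` (`λ > 0`), together with `Re ω(h) ≤ E_up`, gives
`(c - E_up)/λ ≤ Re ω(v)`. [cite: Han2020Bootstrap, §2 eq. (3)] -/
theorem le_re_map_of_scanCertificate (ω : 𝓐 →ₗ[ℂ] ℂ)
    (hpos : ∀ a, 0 ≤ ω (star a * a)) (hone : ω 1 = 1) {Λ : Matrix m m ℂ} (hΛ : Λ.PosSemidef)
    (O : m → 𝓐) {h v n : 𝓐} (hn : ω n = 0) {Eup lam c : ℝ} (hlam : 0 < lam)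
    (hE : (ω h).re ≤ Eup)
    (hcert : h + (lam : ℂ) • v - (c : ℂ) • (1 : 𝓐) = gramForm Λ O + n) :
    (c - Eup) / lam ≤ (ω v).re := by
  have h1 := le_re_map_of_certificate ω hpos hone hΛ O hn hcert
  rw [map_add, map_smul, smul_eq_mul, Complex.add_re, Complex.re_ofReal_mul] at h1
  exact obs_lower_of_window hE h1 hlam

/-- **Scan form, upper (D1).** `h - λ v - c·1 = Σᵢⱼ Λᵢⱼ Oᵢ⋆Oⱼ + n` (`λ > 0`), `Re ω(h) ≤ E_up`
⇒ `Re ω(v) ≤ (E_up - c)/λ`. [cite: Han2020Bootstrap, §2 eq. (3)] -/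
theorem re_map_le_of_scanCertificate (ω : 𝓐 →ₗ[ℂ] ℂ)
    (hpos : ∀ a, 0 ≤ ω (star a * a)) (hone : ω 1 = 1) {Λ : Matrix m m ℂ} (hΛ : Λ.PosSemidef)
    (O : m → 𝓐) {h v n : 𝓐} (hn : ω n = 0) {Eup lam c : ℝ} (hlam : 0 < lam)
    (hE : (ω h).re ≤ Eup)
    (hcert : h - (lam : ℂ) • v - (c : ℂ) • (1 : 𝓐) = gramForm Λ O + n) :
    (ω v).re ≤ (Eup - c) / lam := by
  have h1 := le_re_map_of_certificate ω hpos hone hΛ O hn hcert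
  rw [map_sub, map_smul, smul_eq_mul, Complex.sub_re, Complex.re_ofReal_mul] at h1
  exact obs_upper_of_window hE h1 hlam

end Abstract

/-! ## §3 Matrix instances: tracial ground state, eigenvectors, sector ground states -/

section MatrixInstances

variable {n : Type*} [Fintype n] [DecidableEq n]
variable {m : Type*} [Fintype m] [DecidableEq m]

/-- **Window certificate ⇒ ground-state observable lower bound (tracial state, all symmetries).**
For Hermitian `A` with `E₀(A) ≤ E_up`: an identity
`V - c·1 = Σᵢⱼ Λᵢⱼ Oᵢᴴ Oⱼ + (Σₖ (A Xₖ - Xₖ A) + Σₗ (Uₗ Yₗ Uₗᴴ - Yₗ)) + μ·(E_up·1 - A)` with `Λ ⪰ 0`,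
`μ ≥ 0`, unitaries `Uₗ` commuting with `A`, proves `c ≤ Re ω₀(V)` for the tracial ground state
`ω₀ = Matrix.groundStateFunctional A` (which is positive, normalised, has `ω₀(A) = E₀`, kills
commutators with `A` and symmetry defects). [cite: WangEtAl2024, §3 eq. (4)] -/
theorem re_groundStateFunctional_ge_of_windowCertificate [Nonempty n] {A : Matrix n n ℂ}
    (hA : A.IsHermitian) {Λ : Matrix m m ℂ} (hΛ : Λ.PosSemidef) (O : m → Matrix n n ℂ)
    {κ : Type*} (s : Finset κ) (X : κ → Matrix n n ℂ)
    {ι : Type*} (t : Finset ι) (U Y : ι → Matrix n n ℂ)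
    (hU : ∀ l ∈ t, U l * A = A * U l) (hUU : ∀ l ∈ t, (U l)ᴴ * U l = 1)
    {V : Matrix n n ℂ} {Eup μ c : ℝ} (hμ : 0 ≤ μ) (hE : A.groundEnergy ≤ Eup)
    (hcert : V - (c : ℂ) • (1 : Matrix n n ℂ) =
      gramForm Λ O + (∑ k ∈ s, (A * X k - X k * A) + ∑ l ∈ t, (U l * Y l * (U l)ᴴ - Y l)) +
        (μ : ℂ) • ((Eup : ℂ) • (1 : Matrix n n ℂ) - A)) :
    c ≤ (A.groundStateFunctional V).re := by
  set ω := A.groundStateFunctional with hω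
  have hpos : ∀ a : Matrix n n ℂ, 0 ≤ ω (star a * a) := fun a => by
    rw [hω, Matrix.star_eq_conjTranspose]; exact Matrix.groundStateFunctional_nonneg A a
  have hone : ω 1 = 1 := Matrix.groundStateFunctional_one hA
  have hnull : ω (∑ k ∈ s, (A * X k - X k * A) + ∑ l ∈ t, (U l * Y l * (U l)ᴴ - Y l)) = 0 := by
    rw [map_add, map_sum, map_sum]
    have h1 : ∀ k ∈ s, ω (A * X k - X k * A) = 0 := fun k _ => by
      rw [map_sub, hω, Matrix.groundStateFunctional_hamiltonian_mul hA,
        Matrix.groundStateFunctional_mul_hamiltonian, sub_self]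
    have h2 : ∀ l ∈ t, ω (U l * Y l * (U l)ᴴ - Y l) = 0 := fun l hl => by
      rw [map_sub, hω, Matrix.groundStateFunctional_conj_of_commute hA (hU l hl) (hUU l hl),
        sub_self]
    rw [Finset.sum_eq_zero h1, Finset.sum_eq_zero h2, add_zero]
  have hE' : (ω A).re ≤ Eup := by
    rw [hω, Matrix.groundStateFunctional_hamiltonian hA, Complex.ofReal_re]; exact hE
  exact le_re_map_of_windowCertificate ω hpos hone hΛ O hnull hμ hE' hcert

/-- Upper-bound reading: a window certificate for `-V` bounds `Re ω₀(V)` ABOVE by `-c`.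
[cite: WangEtAl2024, §3 eq. (4)] -/
theorem re_groundStateFunctional_le_of_windowCertificate [Nonempty n] {A : Matrix n n ℂ}
    (hA : A.IsHermitian) {Λ : Matrix m m ℂ} (hΛ : Λ.PosSemidef) (O : m → Matrix n n ℂ)
    {κ : Type*} (s : Finset κ) (X : κ → Matrix n n ℂ)
    {ι : Type*} (t : Finset ι) (U Y : ι → Matrix n n ℂ)
    (hU : ∀ l ∈ t, U l * A = A * U l) (hUU : ∀ l ∈ t, (U l)ᴴ * U l = 1)
    {V : Matrix n n ℂ} {Eup μ c : ℝ} (hμ : 0 ≤ μ) (hE : A.groundEnergy ≤ Eup)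
    (hcert : -V - (c : ℂ) • (1 : Matrix n n ℂ) =
      gramForm Λ O + (∑ k ∈ s, (A * X k - X k * A) + ∑ l ∈ t, (U l * Y l * (U l)ᴴ - Y l)) +
        (μ : ℂ) • ((Eup : ℂ) • (1 : Matrix n n ℂ) - A)) :
    (A.groundStateFunctional V).re ≤ -c := by
  have h := re_groundStateFunctional_ge_of_windowCertificate hA hΛ O s X t U Y hU hUU hμ hE hcert
  rw [map_neg, Complex.neg_re] at h
  linarith

/-- **Rounded window certificate (tracial state).** As
`re_groundStateFunctional_ge_of_windowCertificate` with an explicit residual `r`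
(`V - c·1 = … + μ·(E_up·1 - A) + r`) whose ground-state expectation is bounded below,
`-ε ≤ Re ω₀(r)` — e.g. termwise by `Σ |coeff|` over contraction monomials
(`neg_sum_norm_le_re_map_sum`): `c - ε ≤ Re ω₀(V)`. This is the shape a float SDP solution takes
after rounding `Λ` to an exactly PSD rational matrix. [cite: KullEtAl2024, §5.3] -/
theorem re_groundStateFunctional_ge_of_windowCertificate_residual [Nonempty n] {A : Matrix n n ℂ}
    (hA : A.IsHermitian) {Λ : Matrix m m ℂ} (hΛ : Λ.PosSemidef) (O : m → Matrix n n ℂ)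
    {κ : Type*} (s : Finset κ) (X : κ → Matrix n n ℂ)
    {ι : Type*} (t : Finset ι) (U Y : ι → Matrix n n ℂ)
    (hU : ∀ l ∈ t, U l * A = A * U l) (hUU : ∀ l ∈ t, (U l)ᴴ * U l = 1)
    {V r : Matrix n n ℂ} {ε : ℝ} (hr : -ε ≤ (A.groundStateFunctional r).re)
    {Eup μ c : ℝ} (hμ : 0 ≤ μ) (hE : A.groundEnergy ≤ Eup)
    (hcert : V - (c : ℂ) • (1 : Matrix n n ℂ) =
      gramForm Λ O + (∑ k ∈ s, (A * X k - X k * A) + ∑ l ∈ t, (U l * Y l * (U l)ᴴ - Y l)) +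
        (μ : ℂ) • ((Eup : ℂ) • (1 : Matrix n n ℂ) - A) + r) :
    c - ε ≤ (A.groundStateFunctional V).re := by
  set ω := A.groundStateFunctional with hω
  have hpos : ∀ a : Matrix n n ℂ, 0 ≤ ω (star a * a) := fun a => by
    rw [hω, Matrix.star_eq_conjTranspose]; exact Matrix.groundStateFunctional_nonneg A a
  have hone : ω 1 = 1 := Matrix.groundStateFunctional_one hA
  have hnull : ω (∑ k ∈ s, (A * X k - X k * A) + ∑ l ∈ t, (U l * Y l * (U l)ᴴ - Y l)) = 0 := by
    rw [map_add, map_sum, map_sum]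
    have h1 : ∀ k ∈ s, ω (A * X k - X k * A) = 0 := fun k _ => by
      rw [map_sub, hω, Matrix.groundStateFunctional_hamiltonian_mul hA,
        Matrix.groundStateFunctional_mul_hamiltonian, sub_self]
    have h2 : ∀ l ∈ t, ω (U l * Y l * (U l)ᴴ - Y l) = 0 := fun l hl => by
      rw [map_sub, hω, Matrix.groundStateFunctional_conj_of_commute hA (hU l hl) (hUU l hl),
        sub_self]
    rw [Finset.sum_eq_zero h1, Finset.sum_eq_zero h2, add_zero]
  have hE' : (ω A).re ≤ Eup := by
    rw [hω, Matrix.groundStateFunctional_hamiltonian hA, Complex.ofReal_re]; exact hE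
  exact le_re_map_of_windowCertificate_residual ω hpos hone hΛ O hnull hr hμ hE' hcert

/-- **Scan form ⇒ ground-state observable bracket (D1, tracial state).** For Hermitian `A`, `V`,
`λ > 0`, `E₀(A) ≤ E_up` and ANY certified `c ≤ E₀(A + λV)`: `(c - E_up)/λ ≤ Re ω₀(V)`, by the
variational principle `E₀(A + λV) ≤ Re ω₀(A + λV) = E₀(A) + λ Re ω₀(V)`
(`Matrix.groundEnergy_le_groundStateFunctional_re`). [folklore] -/
theorem re_groundStateFunctional_ge_of_groundEnergy_add_smul [Nonempty n] {A V : Matrix n n ℂ}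
    (hA : A.IsHermitian) (hV : V.IsHermitian) {Eup lam c : ℝ} (hlam : 0 < lam)
    (hE : A.groundEnergy ≤ Eup) (hc : c ≤ (A + (lam : ℂ) • V).groundEnergy) :
    (c - Eup) / lam ≤ (A.groundStateFunctional V).re := by
  have hAV : (A + (lam : ℂ) • V).IsHermitian :=
    hA.add (IsHermitian.smul hV (by rw [isSelfAdjoint_iff, Complex.star_def, Complex.conj_ofReal]))
  have h := Matrix.groundEnergy_le_groundStateFunctional_re hA hAV
  rw [map_add, map_smul, smul_eq_mul, Complex.add_re, Complex.re_ofReal_mul,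
    Matrix.groundStateFunctional_hamiltonian hA, Complex.ofReal_re] at h
  exact obs_lower_of_window hE (hc.trans h) hlam

/-- Scan form, upper: `c ≤ E₀(A - λV)`, `E₀(A) ≤ E_up`, `λ > 0` ⇒ `Re ω₀(V) ≤ (E_up - c)/λ`.
[folklore] -/
theorem re_groundStateFunctional_le_of_groundEnergy_sub_smul [Nonempty n] {A V : Matrix n n ℂ}
    (hA : A.IsHermitian) (hV : V.IsHermitian) {Eup lam c : ℝ} (hlam : 0 < lam)
    (hE : A.groundEnergy ≤ Eup) (hc : c ≤ (A - (lam : ℂ) • V).groundEnergy) :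
    (A.groundStateFunctional V).re ≤ (Eup - c) / lam := by
  have hAV : (A - (lam : ℂ) • V).IsHermitian :=
    hA.sub (IsHermitian.smul hV (by rw [isSelfAdjoint_iff, Complex.star_def, Complex.conj_ofReal]))
  have h := Matrix.groundEnergy_le_groundStateFunctional_re hA hAV
  rw [map_sub, map_smul, smul_eq_mul, Complex.sub_re, Complex.re_ofReal_mul,
    Matrix.groundStateFunctional_hamiltonian hA, Complex.ofReal_re] at h
  exact obs_upper_of_window hE (hc.trans h) hlam

end MatrixInstances

end

end Summit.HubbardSuperconductivity.HubbardLadder
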